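import Summits.QuantumFields.BalabanUV.Beta.D1BFx.PackedTowerSlotsGram
import Summits.QuantumFields.BalabanUV.Beta.D1BFx.PackedTowerLimits

/-!
# `BalabanUV.Beta.D1BFx.PackedTowerCombine` — road «BF-x» for binder row D1, slot (K), chain step (I) «(A1)-PACKED», brick (B6) «A1-PACKED» WITH THE
# TOWER SLOTS AT RESPONSE-PACKED JETS DISCHARGED (FILE 4 of this lineage's (B5) filing): **the `ℤ⁴` identity of the COVARIANT organisation from the
# per-torus letters of the literal at RESPONSE-PACKED jets, the two tower slots («GRAM-COV», «COMB-FP») being THEOREMS (FILES 2a∕2b) whose limits are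
# THEOREMS (FILE 3)** — gen 21's `KCombineCovStrippedUniform.hessKer_transfer_road_cov_stripped_of_uniform` re-run with the gauge ∕ co-frame jets
# pinned to the PACKED CONVENTION ∕ PACKED TB4-W jets instead of the single-bond ones; what stays displayed is exactly what (B3) proves or displays

HONEST FRAMING (cell contract, verbatim): «discharging `BetaPertH` makes Bałaban's UV stability UNCONDITIONAL — a real constructive-QFT
result; it is NOT the continuum limit and NOT the Clay problem.»  HONEST DEPENDENCY (verbatim): «continuum YM on T⁴ ⇐ BetaPertH ∧ nine
spine estimates (0/9 proved); BetaPertH ⇐ (D1) ∧ (D4) ∧ CAP+tail; G-an2-4 gates asym, D1 and NE2/3/4.»  THIS MODULE DISCHARGES NOTHING of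
D1 ∕ BetaPertH: [folklore] a composition BY NAME — `KCombineCovColourTorus.identity_array_currency_cov_What0_stripped` per torus, its two tower
slots supplied by FILE 2a `hessT_combFP_packed_eq_arr` and FILE 2b `hessT_tgramCov_packed_eq_arr`, the `ℤ⁴` passage by gen 21's
`MovingTableSockets.hessKer_transfer_road_cov_limits_of_uniform` ∕ `tendsto_hessT_NlegRoad_of_uniform` with the tower limits of FILE 3
(`tendsto_gramCov_tower_packed`, `tendsto_combFP_tower_packed`).  No `def`, no `def … : Prop`, nothing cited, 0 sorry.  NOT summit progress;
NOT BetaPertH, NOT continuum, NOT Clay.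
STILL DISPLAYED (= (B3)'s output or the literal's, at the k-th torus): the parity types `hk•` and the (A2-M∕N) dictionary letters `hJM• k`∕`hJN• k` of
the literal's form jets at the k-th (p-DEPENDENT, F-g16-1) tables, the ONE-SIDED WARD-L letters `a•` and the kinematic letters `b•` against the PACKED
gauge jets, the uniform `BiLoc` letters and entrywise limits of the four M∕N table families ((B4e)∕«WRAP-UNIFORM»∕«WRAP-LIMIT»), the response letters
`hrₛ hrₜ` ((B4b)), the decay of the two packing weight families at the base bonds (`colH` of the literal's resolvent, (B3) PART 1), `Spr (Ga (m+1) a)`,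
`0 < a`, `r ∈ box 4 (m+1)`.

ABSOLUTE RULE (cell, verbatim): «No internally-minted statement may enter as a cited fact. Every hypothesis is either kernel-proved in this
package or a verbatim quotation of a PUBLISHED theorem with page reference. The manuscript(s) under audit are NOT citable for their own
disputed steps — they are the thing under adjudication; programme-internal (2001/route/tribunal) claims are never citable.»

CONTENT (all [folklore]): `transpose_sum_smul_Ajet₁`, `transpose_sum_sum_smul_Ajet₁₁` (parity of the packed co-frame weight jets) and
**`hessKer_transfer_road_cov_packed_of_uniform`**:
`hessKer G_M 𝒱M∞ 𝒲M∞ μ ν z + hessKer (Cgh (m+1) a) ℒ ℒ₂ μ ν z = hessKer (NlegRoad m a) 𝒱N∞ 𝒲N∞ μ ν z + 2·hessKer idK1 𝒳 𝒳₂ μ ν z`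
with the PACKED tower families `ℒ κ′ v := Σ_κ wsum (w κ′ v κ) (Lgh κ)`, `ℒ₂` (product form), `𝒳 κ′ v := Σ_κ wsum (w κ′ v κ) (nFcol κ)`,
`𝒳₂ κ′ v l v′ := Σ_κ wsum (w κ′ v κ) (u ↦ w l v′ κ u · nFcol κ u)` of the bond-indexed p-FREE packing weights `w`.
Unit `b2b-balaban-beta-d1-formalise-leaf-03` (gen 22); road owner `b2b-balaban-beta-d1-p2` (`A1-PACKED-SPEC.md` v0.4 §9, bricks (B5)∕(B6)).
-/

noncomputable section

namespace Summit.QuantumFields.BalabanUV.Beta.D1BFx.PackedTowerCombine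

open Matrix Filter Topology
open scoped BigOperators
open Literature.Probability.LatticeModels (TorusSite)
open Literature.MathematicalPhysics.QuantumFieldTheory.Balaban1983to89
open Literature.MathematicalPhysics.QuantumFieldTheory.Balaban1983to89.Beta
open Literature.MathematicalPhysics.QuantumFieldTheory.Balaban1983to89.Beta.Composition (kkt)
open B12Sec2to5 (l1 l1_nonneg)
open ExpKernelCalculus (MKer Decays BiLoc comp hessKer)
open AffineAveraging (box toSite unitVec)
open OneStepResolventKernel (Fib wsum)
open OneStepKernelFamily (KInvStep)
open Summit.QuantumFields.BalabanUV.Beta.TameKernelCalculus (Spr)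
open Summit.QuantumFields.BalabanUV.Beta.AxialDressingRooted (coDressKBmAt)
open Summit.QuantumFields.BalabanUV.Beta.D1BFx.FibredPeriodisation (periodiseF)
open Summit.QuantumFields.BalabanUV.Beta.D1BFx.SortedKernels (blocksHat)
open Summit.QuantumFields.BalabanUV.Beta.D1BFx.SortedPack (sortK)
open Summit.QuantumFields.BalabanUV.Beta.D1BFx.SortedReblocking (torusBlockEquiv)
open Summit.QuantumFields.BalabanUV.Beta.D1BFx.SortedEmbedding (e₁)
open Summit.QuantumFields.BalabanUV.Beta.D1BFx.PeriodicArrays (arr toF)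
open Summit.QuantumFields.BalabanUV.Beta.D1BFx.MixedVarPackedHess (hessT)
open Summit.QuantumFields.BalabanUV.Beta.D1BFx.GramWeightJets (gram₀)
open Summit.QuantumFields.BalabanUV.Beta.D1BFx.GramWeightColourLift (tj₂ tgram₁ tgramMix)
open Summit.QuantumFields.BalabanUV.Beta.D1BFx.TorusCombKKT (I J CombRows tauT Khat Qhat)
open Summit.QuantumFields.BalabanUV.Beta.D1BFx.TorusGaugeBasis (What0)
open Summit.QuantumFields.BalabanUV.Beta.D1BFx.TorusGaugeBasisMatrix (Nhat)
open Summit.QuantumFields.BalabanUV.Beta.D1BFx.TorusCoframeJets (Djet Tjet₀ Tjet₁ Tjet₁₁ Ajet₀ Ajet₁ Ajet₁₁)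
open Summit.QuantumFields.BalabanUV.Beta.D1BFx.RWeightedLegPack (NlegRoad)
open Summit.QuantumFields.BalabanUV.Beta.D1BFx.GaugeJetLocal (idK1)
open Summit.QuantumFields.BalabanUV.Beta.D1BFx.KGhostLeg (Cgh)
open Summit.QuantumFields.BalabanUV.Beta.D1BFx.GhostStencil (ghCur)
open Summit.QuantumFields.BalabanUV.Beta.D1BFx.TorusGhostWordArrays (lapU Lgh)
open Summit.QuantumFields.BalabanUV.Beta.D1BFx.TorusGhostPairStencils (gh₂)
open Summit.QuantumFields.BalabanUV.Beta.D1BFx.CombFPWordArrays (nFcol)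
open Summit.QuantumFields.BalabanUV.Beta.D1BFx.KCombineCovLegs (det_Tjet₀_mul_What0_ne_zero det_Ajet₀_Nhat_ne_zero det_gram₀_What0_road_ne_zero
  inv_kkt_gram₀_Tjet_Nhat_eq_blocksHat)
open Summit.QuantumFields.BalabanUV.Beta.D1BFx.KCombineCovColourTorus (identity_array_currency_cov_What0_stripped transpose_Ajet₀ transpose_Ajet₁
  transpose_Ajet₁₁)
open Summit.QuantumFields.BalabanUV.Beta.D1BFx.MovingTableSockets (hessKer_transfer_road_cov_limits_of_uniform tendsto_hessT_NlegRoad_of_uniform)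
open Summit.QuantumFields.BalabanUV.Beta.D1BFx.PackedTowerSlots (hessT_combFP_packed_eq_arr)
open Summit.QuantumFields.BalabanUV.Beta.D1BFx.PackedTowerSlotsGram (hessT_tgramCov_packed_eq_arr)
open Summit.QuantumFields.BalabanUV.Beta.D1BFx.PackedTowerLimits (tendsto_combFP_tower_packed tendsto_gramCov_tower_packed)

/-! ## Parity of the packed co-frame weight jets -/

section Parity

variable {σ : Type*} [Fintype σ] (s : ℕ) [NeZero s] {ρ : Type*} [Fintype ρ] [DecidableEq ρ] (N : Matrix (Site 4 s) ρ ℝ)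

/-- [folklore] The packed first co-frame weight jet is ANTISYMMETRIC (`transpose_Ajet₁` per bond). -/
theorem transpose_sum_smul_Ajet₁ (c : σ → ℝ) (b : σ → Site 4 s × Fin 4) :
    (∑ k, c k • Ajet₁ s (b k) N)ᵀ = -∑ k, c k • Ajet₁ s (b k) N := by
  rw [Matrix.transpose_sum, ← Finset.sum_neg_distrib]
  refine Finset.sum_congr rfl fun k _ => ?_
  rw [Matrix.transpose_smul, transpose_Ajet₁, smul_neg]

/-- [folklore] The packed mixed co-frame weight jet is SYMMETRIC (`transpose_Ajet₁₁` per bond pair). -/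
theorem transpose_sum_sum_smul_Ajet₁₁ (c : σ → σ → ℝ) (b : σ → Site 4 s × Fin 4) :
    (∑ k, ∑ l, c k l • Ajet₁₁ s (b k) (b l) N)ᵀ = ∑ k, ∑ l, c k l • Ajet₁₁ s (b k) (b l) N := by
  rw [Matrix.transpose_sum]
  refine Finset.sum_congr rfl fun k _ => ?_
  rw [Matrix.transpose_sum]
  refine Finset.sum_congr rfl fun l _ => ?_
  rw [Matrix.transpose_smul, transpose_Ajet₁₁]

end Parity

/-! ## The `ℤ⁴` identity with both tower slots at packed jets discharged -/

section Combine

variable (m : ℕ) {a : ℝ} {r : Fin 4 → ℕ}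

/-- [folklore] **(B6) «A1-PACKED» WITH THE PACKED TOWER SLOTS DISCHARGED — «K-COV-C» PART 3 AT RESPONSE-PACKED JETS.**  For `0 < a`, `Spr (Ga (m+1) a)`,
`r ∈ box 4 (m+1)`, k-indexed M∕N table families under (u1)∕(u2) with limits `𝒱M∞ 𝒲M∞ 𝒱N∞ 𝒲N∞`, coarse periods `p k → ∞`, bond-indexed p-FREE packing
weights `w` (decay letters at `(μ,0)`, `(ν,z)`, rate `0 < δ ≤ ½`), per-torus responses `rₛ k`, `rₜ k` (letters `hrₛ hrₜ`), the gauge jets PACKED from THE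
CONVENTION and the co-frame jets PACKED from TB4-W by them (pinning letters), the literal's parity-typed form ∕ constraint jets with their ONE-SIDED WARD-L and
kinematic letters against the packed gauge jets, and the (A2-M∕N) dictionary AT THE k-TH TABLES:
`hessKer G_M 𝒱M∞ 𝒲M∞ μ ν z + hessKer (Cgh (m+1) a) ℒ ℒ₂ μ ν z = hessKer (NlegRoad m a) 𝒱N∞ 𝒲N∞ μ ν z + 2·hessKer idK1 𝒳 𝒳₂ μ ν z`,
the tower families being the PACKED ghost ∕ comb words of FILES 2a∕2b∕3. -/
theorem hessKer_transfer_road_cov_packed_of_uniform (ha : 0 < a) (hGa : Spr (GluonLeg.Ga (m + 1) a)) (hr : r ∈ box (3 + 1) (m + 1))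
    (𝒱M : ℕ → Fin 4 → (Fin 4 → ℤ) → MKer 4 (Fib 3)) (𝒲M : ℕ → Fin 4 → (Fin 4 → ℤ) → Fin 4 → (Fin 4 → ℤ) → MKer 4 (Fib 3))
    (𝒱Minf : Fin 4 → (Fin 4 → ℤ) → MKer 4 (Fib 3)) (𝒲Minf : Fin 4 → (Fin 4 → ℤ) → Fin 4 → (Fin 4 → ℤ) → MKer 4 (Fib 3))
    (𝒱N : ℕ → Fin 4 → (Fin 4 → ℤ) → MKer 4 (Fib 3)) (𝒲N : ℕ → Fin 4 → (Fin 4 → ℤ) → Fin 4 → (Fin 4 → ℤ) → MKer 4 (Fib 3))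
    (𝒱Ninf : Fin 4 → (Fin 4 → ℤ) → MKer 4 (Fib 3)) (𝒲Ninf : Fin 4 → (Fin 4 → ℤ) → Fin 4 → (Fin 4 → ℤ) → MKer 4 (Fib 3))
    (μ ν : Fin 4) (z : Fin 4 → ℤ)
    {PM PM' QM QM' PN PN' QN QN' : Fin 4 → ℤ} {CvM CvM' CM δM CvN CvN' CN δN : ℝ}
    (hVM : ∀ k, BiLoc (𝒱M k μ 0) PM PM' CvM δM) (hVM' : ∀ k, BiLoc (𝒱M k ν z) QM' QM CvM' δM)
    (hWM : ∀ k, BiLoc (𝒲M k μ 0 ν z) PM QM CM δM) (hδM : 0 < δM)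
    (hlimVM : ∀ x y c b, Tendsto (fun k => 𝒱M k μ 0 x y c b) atTop (𝓝 (𝒱Minf μ 0 x y c b)))
    (hlimVM' : ∀ x y c b, Tendsto (fun k => 𝒱M k ν z x y c b) atTop (𝓝 (𝒱Minf ν z x y c b)))
    (hlimWM : ∀ x y c b, Tendsto (fun k => 𝒲M k μ 0 ν z x y c b) atTop (𝓝 (𝒲Minf μ 0 ν z x y c b)))
    (hVN : ∀ k, BiLoc (𝒱N k μ 0) PN PN' CvN δN) (hVN' : ∀ k, BiLoc (𝒱N k ν z) QN' QN CvN' δN)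
    (hWN : ∀ k, BiLoc (𝒲N k μ 0 ν z) PN QN CN δN) (hδN : 0 < δN)
    (hlimVN : ∀ x y c b, Tendsto (fun k => 𝒱N k μ 0 x y c b) atTop (𝓝 (𝒱Ninf μ 0 x y c b)))
    (hlimVN' : ∀ x y c b, Tendsto (fun k => 𝒱N k ν z x y c b) atTop (𝓝 (𝒱Ninf ν z x y c b)))
    (hlimWN : ∀ x y c b, Tendsto (fun k => 𝒲N k μ 0 ν z x y c b) atTop (𝓝 (𝒲Ninf μ 0 ν z x y c b)))
    {p : ℕ → ℕ} [∀ k, NeZero (p k)] (hp : Tendsto p atTop atTop)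
    -- the packing weights (bond-indexed, p-FREE) and the per-torus responses
    (w : Fin 4 → (Fin 4 → ℤ) → Fin 4 → (Fin 4 → ℤ) → ℝ) {CS CT δ : ℝ} {PS PT : Fin 4 → ℤ}
    (hwS : ∀ κ u, |w μ 0 κ u| ≤ CS * Real.exp (-δ * l1 (u - PS))) (hwT : ∀ κ u, |w ν z κ u| ≤ CT * Real.exp (-δ * l1 (u - PT)))
    (hδ : 0 < δ) (hδ1 : δ ≤ 1 / 2)
    (rS rT : ∀ k, I 3 (m + 1) (p k) → ℝ)
    (hrS : ∀ k i, rS k i = ∑' t : Fin 4 → ℤ,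
      w μ 0 i.2.2 (imageShift ((m + 1) * p k) (windowMap 4 ((m + 1) * p k) (torusBlockEquiv (m + 1) (p k) (i.1, i.2.1))) t))
    (hrT : ∀ k i, rT k i = ∑' t : Fin 4 → ℤ,
      w ν z i.2.2 (imageShift ((m + 1) * p k) (windowMap 4 ((m + 1) * p k) (torusBlockEquiv (m + 1) (p k) (i.1, i.2.1))) t))
    -- co-frame data pinned to TB4-W's jets PACKED by the responses («COFRAME-PACK»)
    (T₀ Tₛ Tₜ Tₛₜ : ∀ k, Matrix (CombRows (toSite r) (m + 1) (p k)) (I 3 (m + 1) (p k)) ℝ)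
    (A₀ Aₛ Aₜ Aₛₜ : ∀ k, Matrix (CombRows (toSite r) (m + 1) (p k)) (CombRows (toSite r) (m + 1) (p k)) ℝ)
    (hT₀ : ∀ k, T₀ k = Tjet₀ ((m + 1) * p k) (Nhat r (m + 1) (p k)) (e₁ (m + 1) (p k)))
    (hTₛ : ∀ k, Tₛ k = ∑ i : I 3 (m + 1) (p k), rS k i • Tjet₁ ((m + 1) * p k) (e₁ (m + 1) (p k) i) (Nhat r (m + 1) (p k)) (e₁ (m + 1) (p k)))
    (hTₜ : ∀ k, Tₜ k = ∑ i : I 3 (m + 1) (p k), rT k i • Tjet₁ ((m + 1) * p k) (e₁ (m + 1) (p k) i) (Nhat r (m + 1) (p k)) (e₁ (m + 1) (p k)))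
    (hTₛₜ : ∀ k, Tₛₜ k = ∑ i : I 3 (m + 1) (p k), ∑ j : I 3 (m + 1) (p k), (rS k i * rT k j) •
      Tjet₁₁ ((m + 1) * p k) (e₁ (m + 1) (p k) i) (e₁ (m + 1) (p k) j) (Nhat r (m + 1) (p k)) (e₁ (m + 1) (p k)))
    (hA₀ : ∀ k, A₀ k = Ajet₀ ((m + 1) * p k) (Nhat r (m + 1) (p k)))
    (hAₛ : ∀ k, Aₛ k = ∑ i : I 3 (m + 1) (p k), rS k i • Ajet₁ ((m + 1) * p k) (e₁ (m + 1) (p k) i) (Nhat r (m + 1) (p k)))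
    (hAₜ : ∀ k, Aₜ k = ∑ i : I 3 (m + 1) (p k), rT k i • Ajet₁ ((m + 1) * p k) (e₁ (m + 1) (p k) i) (Nhat r (m + 1) (p k)))
    (hAₛₜ : ∀ k, Aₛₜ k = ∑ i : I 3 (m + 1) (p k), ∑ j : I 3 (m + 1) (p k), (rS k i * rT k j) •
      Ajet₁₁ ((m + 1) * p k) (e₁ (m + 1) (p k) i) (e₁ (m + 1) (p k) j) (Nhat r (m + 1) (p k)))
    -- gauge jets pinned to THE CONVENTION PACKED by the responses
    (Wₛ Wₜ Wₛₜ : ∀ k, Matrix (I 3 (m + 1) (p k)) (CombRows (toSite r) (m + 1) (p k)) ℝ)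
    (hWₛ : ∀ k, Wₛ k = ∑ i : I 3 (m + 1) (p k), rS k i •
      ((Djet ((m + 1) * p k) (e₁ (m + 1) (p k) i)).submatrix (e₁ (m + 1) (p k)) id * Nhat r (m + 1) (p k)))
    (hWₜ : ∀ k, Wₜ k = ∑ i : I 3 (m + 1) (p k), rT k i •
      ((Djet ((m + 1) * p k) (e₁ (m + 1) (p k) i)).submatrix (e₁ (m + 1) (p k)) id * Nhat r (m + 1) (p k)))
    (hWₛₜ : ∀ k, Wₛₜ k = ∑ i : I 3 (m + 1) (p k), ∑ j : I 3 (m + 1) (p k), (rS k i * rT k j) •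
      (if i = j then (Djet ((m + 1) * p k) (e₁ (m + 1) (p k) i)).submatrix (e₁ (m + 1) (p k)) id * Nhat r (m + 1) (p k) else 0))
    -- the literal's parity-typed jets, WARD-L one-sided letters, kinematic letters (per torus)
    (kₛ kₜ kₛₜ : ∀ k, Matrix (I 3 (m + 1) (p k)) (I 3 (m + 1) (p k)) ℝ) (qₛ qₜ qₛₜ : ∀ k, Matrix (J 3 (p k)) (I 3 (m + 1) (p k)) ℝ)
    (hkₛ : ∀ k, (kₛ k)ᵀ = -kₛ k) (hkₜ : ∀ k, (kₜ k)ᵀ = -kₜ k) (hkₛₜ : ∀ k, (kₛₜ k)ᵀ = kₛₜ k)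
    (aₛ : ∀ k, kₛ k * What0 r (m + 1) (p k) + Khat (d := 3) (m + 1) (p k) * Wₛ k = 0)
    (aₜ : ∀ k, kₜ k * What0 r (m + 1) (p k) + Khat (d := 3) (m + 1) (p k) * Wₜ k = 0)
    (aₛₜ : ∀ k, kₛₜ k * What0 r (m + 1) (p k) + kₛ k * Wₜ k + kₜ k * Wₛ k + Khat (d := 3) (m + 1) (p k) * Wₛₜ k = 0)
    (bₛ : ∀ k, qₛ k * What0 r (m + 1) (p k) + Qhat (d := 3) (m + 1) (p k) * Wₛ k = 0)
    (bₜ : ∀ k, qₜ k * What0 r (m + 1) (p k) + Qhat (d := 3) (m + 1) (p k) * Wₜ k = 0)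
    (bₛₜ : ∀ k, qₛₜ k * What0 r (m + 1) (p k) + qₛ k * Wₜ k + qₜ k * Wₛ k + Qhat (d := 3) (m + 1) (p k) * Wₛₜ k = 0)
    -- the (A2-M∕N) dictionary AT THE k-TH TABLES
    (hJM : ∀ k, kkt (kₛ k) (qₛ k) = blocksHat (p k) (sortK (m + 1) (arr ((m + 1) * p k) (𝒱M k μ 0))))
    (hJM' : ∀ k, kkt (kₜ k) (qₜ k) = blocksHat (p k) (sortK (m + 1) (arr ((m + 1) * p k) (𝒱M k ν z))))
    (hJM'' : ∀ k, kkt (kₛₜ k) (qₛₜ k) * Matrix.fromBlocks (1 : Matrix (I 3 (m + 1) (p k)) (I 3 (m + 1) (p k)) ℝ) 0 0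
        (-1 : Matrix (J 3 (p k)) (J 3 (p k)) ℝ) = blocksHat (p k) (sortK (m + 1) (arr ((m + 1) * p k) (𝒲M k μ 0 ν z))))
    (hJN : ∀ k, tj₂ (kₛ k + tgram₁ (T₀ k) (Tₛ k) (A₀ k) (Aₛ k)) (qₛ k) = blocksHat (p k) (sortK (m + 1) (arr ((m + 1) * p k) (𝒱N k μ 0))))
    (hJN' : ∀ k, tj₂ (kₜ k + tgram₁ (T₀ k) (Tₜ k) (A₀ k) (Aₜ k)) (qₜ k) = blocksHat (p k) (sortK (m + 1) (arr ((m + 1) * p k) (𝒱N k ν z))))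
    (hJN'' : ∀ k, kkt (kₛₜ k + tgramMix (T₀ k) (Tₛ k) (Tₜ k) (Tₛₜ k) (A₀ k) (Aₛ k) (Aₜ k) (Aₛₜ k)) (qₛₜ k)
        = blocksHat (p k) (sortK (m + 1) (arr ((m + 1) * p k) (𝒲N k μ 0 ν z)))) :
    hessKer (coDressKBmAt (toSite r) (m + 1) (KInvStep (d := 3) (m + 1) 0)) 𝒱Minf 𝒲Minf μ ν z
        + hessKer (Cgh (m + 1) a) (fun κ' v => fun x y a b => ∑ κ : Fin 4, wsum (w κ' v κ) (Lgh κ) x y a b)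
          (fun κ' v l v' =>
            comp (fun x y a b => ∑ κ : Fin 4, wsum (w κ' v κ) (fun u => fun x y a b => w l v' κ u * gh₂ κ u x y a b) x y a b) lapU
              + comp (fun x y a b => ∑ κ : Fin 4, wsum (w κ' v κ) (ghCur κ) x y a b) (fun x y a b => ∑ κ : Fin 4, wsum (w l v' κ) (ghCur κ) x y a b)
              + comp (fun x y a b => ∑ κ : Fin 4, wsum (w l v' κ) (ghCur κ) x y a b) (fun x y a b => ∑ κ : Fin 4, wsum (w κ' v κ) (ghCur κ) x y a b)
              + comp lapU (fun x y a b => ∑ κ : Fin 4, wsum (w κ' v κ) (fun u => fun x y a b => w l v' κ u * gh₂ κ u x y a b) x y a b))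
          μ ν z
      = hessKer (NlegRoad m a) 𝒱Ninf 𝒲Ninf μ ν z
        + 2 * hessKer idK1 (fun κ' v => fun x y a b => ∑ κ : Fin 4, wsum (w κ' v κ) (nFcol r (m + 1) κ) x y a b)
          (fun κ' v l v' => fun x y a b => ∑ κ : Fin 4, wsum (w κ' v κ) (fun u => fun x y a b => w l v' κ u * nFcol r (m + 1) κ u x y a b) x y a b)
          μ ν z := by
  refine hessKer_transfer_road_cov_limits_of_uniform (d := 3) hr 𝒱M 𝒲M 𝒱Minf 𝒲Minf μ ν z hVM hVM' hWM hδM hlimVM hlimVM' hlimWM hp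
    (tendsto_gramCov_tower_packed m ha w μ ν z hwS hwT hδ hδ1 hp)
    (tendsto_hessT_NlegRoad_of_uniform m hGa 𝒱N 𝒲N 𝒱Ninf 𝒲Ninf μ ν z hVN hVN' hWN hδN hlimVN hlimVN' hlimWN hp)
    (tendsto_combFP_tower_packed m hr w μ ν z hwS hwT hδ hp) (Eventually.of_forall fun k => ?_)
  -- the TB4-W data letters on this torus, by name after un-pinning (packed parity by `transpose_sum(_sum)_smul_Ajet•`)
  have hA₀s : (A₀ k)ᵀ = A₀ k := by rw [hA₀ k]; exact transpose_Ajet₀ _ _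
  have hAₛa : (Aₛ k)ᵀ = -Aₛ k := by rw [hAₛ k]; exact transpose_sum_smul_Ajet₁ _ _ _ _
  have hAₜa : (Aₜ k)ᵀ = -Aₜ k := by rw [hAₜ k]; exact transpose_sum_smul_Ajet₁ _ _ _ _
  have hAₛₜs : (Aₛₜ k)ᵀ = Aₛₜ k := by rw [hAₛₜ k]; exact transpose_sum_sum_smul_Ajet₁₁ _ _ _ _
  have hTW : (T₀ k * What0 r (m + 1) (p k)).det ≠ 0 := by rw [hT₀ k]; exact det_Tjet₀_mul_What0_ne_zero m (p k) ha hr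
  have hA : (A₀ k).det ≠ 0 := by rw [hA₀ k]; exact det_Ajet₀_Nhat_ne_zero m (p k) ha hr
  have hΦ : (gram₀ (What0 r (m + 1) (p k)) (Khat (d := 3) (m + 1) (p k) + gram₀ (T₀ k) (A₀ k))).det ≠ 0 := by
    rw [hT₀ k, hA₀ k]; exact det_gram₀_What0_road_ne_zero m (p k) ha hr
  have hLN : (kkt (Khat (d := 3) (m + 1) (p k) + gram₀ (T₀ k) (A₀ k)) (Qhat (d := 3) (m + 1) (p k)))⁻¹
      = blocksHat (p k) (sortK (m + 1) (NlegRoad m a)) := by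
    rw [hT₀ k, hA₀ k]; exact inv_kkt_gram₀_Tjet_Nhat_eq_blocksHat m (p k) ha hGa hr
  -- the two tower slots on this torus AT PACKED JETS (FILES 2a ∕ 2b)
  have hbΦ := hessT_tgramCov_packed_eq_arr m (p k) ha hr (w μ 0) (w ν z) hwS hwT hδ hδ1 (rS k) (rT k) (hrS k) (hrT k) (kₛ k) (kₜ k) (kₛₜ k)
    (hWₛ k) (hWₜ k) (hWₛₜ k) (aₛ k) (aₜ k) (aₛₜ k) (hT₀ k) (hTₛ k) (hTₜ k) (hTₛₜ k) (hA₀ k) (hAₛ k) (hAₜ k) (hAₛₜ k)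
  have heτ := hessT_combFP_packed_eq_arr m (p k) hr (w μ 0) (w ν z) hwS hwT hδ (rS k) (rT k) (hrS k) (hrT k) (hWₛ k) (hWₜ k) (hWₛₜ k)
  exact identity_array_currency_cov_What0_stripped (d := 3) (p k) hr (kₛ k) (kₜ k) (kₛₜ k) (T₀ k) (Tₛ k) (Tₜ k) (Tₛₜ k)
    (A₀ k) (Aₛ k) (Aₜ k) (Aₛₜ k) (Wₛ k) (Wₜ k) (Wₛₜ k) (qₛ k) (qₜ k) (qₛₜ k) (hkₛ k) (hkₜ k) (hkₛₜ k) hA₀s hAₛa hAₜa hAₛₜs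
    (aₛ k) (aₜ k) (aₛₜ k) (bₛ k) (bₜ k) (bₛₜ k) hTW hA hΦ _ _ _ _ _ _ _ _ (hJM k) (hJM' k) (hJM'' k) hLN (hJN k) (hJN' k) (hJN'' k) hbΦ heτ

end Combine

end Summit.QuantumFields.BalabanUV.Beta.D1BFx.PackedTowerCombine

end
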